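import Literature.Computability.AlgebraicComplexity.GenericTrivialStabilizerProofs
import Literature.Computability.AlgebraicComplexity.BI17GenericBinaryCubicPeriod
import Literature.Computability.AlgebraicComplexity.BI17GenericTernaryCubicNonNormal
import Literature.Computability.AlgebraicComplexity.BI17NonNormalOrbitClosuresProofs
import HarnessLib

/-!
# BI 2017 Thm. 2.3 (generic reduced stabilizer period), AS CORRECTED — one theorem

Theorem-only file (cell `val-lit`, row BI2017-A; erratum A21; no definitions, no named facts).
Bürgisser–Ikenmeyer 2017, Thm. 2.3, second sentence (J. Algebra 477; arXiv:1511.02927 L473):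
"We have `a'(D,m) = 1` except in the following cases: `a'(3,2) = 2`, `a'(3,3) = 2`, `a'(4,3) = 2`"
(`D > 2`, `m ≥ 1`). The tree types this verbatim as `BI2017_thm_2_3_period`, which is REFUTED as
typed (`not_BI2017_thm_2_3_period`): the entry `a'(4,3) = 2` is false (erratum A21; generically
`stab = μ₄ · I`, `a(4,3) = 4`, `a'(4,3) = 1`). The CORRECTED sentence —

  `a'(D,m) = 1` for all `D > 2`, `m ≥ 1`, except `a'(3,2) = a'(3,3) = 2` —

is assembled here as ONE kernel theorem over the whole printed range,
`BI2017_thm_2_3_period_corrected`, from the cell's landed pieces: `m ≥ 4` and `(m, D ≥ 4) = (3, ·)`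
(Matsumura–Monsky counting, `BI2017_thm_2_3_period_of_four_le` / `_ternary_of_four_le`,
val-lit-x3 g3), `(3,3)` (`BI2017_prop_A_5_conjunct_one`, val-lit-p5 g4), binary forms
(`BI2017_prop_A_4_holds`, val-lit-t06 g4 / p6 g4 / p5 g4), and the one-variable case proved here
(`hasTrivialStabilizer_of_fin_one`: the stabilizer of `c x^D`, `c ≠ 0`, in `GL₁` is `μ_D`).

Honest framing: bookkeeping of a corrected printed sentence; nothing here bears on VP versus VNP.

## References

* [BurgisserIkenmeyer2017] P. Bürgisser, C. Ikenmeyer, *Fundamental invariants of orbit closures*,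
  J. Algebra 477 (2017) 390–434, §2.1 Thm. 2.3; erratum A21 of the cell's registry.
-/

noncomputable section

open MvPolynomial

namespace Literature.Computability.AlgebraicComplexity

/-! ### One variable -/

section OneVariable

/-- **Forms in one variable have a trivial stabilizer**: a `1 × 1` matrix is a scalar `ζ`, and
`ζ · f = ζ^D f = f` with `f ≠ 0` forces `ζ^D = 1`. (The case `m = 1` of BI 2017 Thm. 2.3:
`a(D,1) = D`, `a'(D,1) = 1`.) [cite: BurgisserIkenmeyer2017, Thm. 2.3] -/
theorem hasTrivialStabilizer_of_fin_one {D : ℕ} {f : MvPolynomial (Fin 1) ℂ} (hf : f.IsHomogeneous D)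
    (hf0 : f ≠ 0) : HasTrivialStabilizer D f := by
  intro γ hγ
  have hγ1 : (γ : Matrix (Fin 1) (Fin 1) ℂ) = (γ : Matrix (Fin 1) (Fin 1) ℂ) 0 0 • (1 : Matrix (Fin 1) (Fin 1) ℂ) := by
    ext i j
    fin_cases i; fin_cases j
    simp
  refine ⟨(γ : Matrix (Fin 1) (Fin 1) ℂ) 0 0, ?_, hγ1⟩
  rw [mem_linStabilizer, linSubstRep_apply, hγ1, linSubst_smul_eq_pow_smul hf, linSubst_one,
    AlgHom.id_apply] at hγ
  have h1 : (((γ : Matrix (Fin 1) (Fin 1) ℂ) 0 0) ^ D - 1) • f = 0 := by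
    rw [sub_smul, one_smul, hγ, sub_self]
  rcases smul_eq_zero.mp h1 with h2 | h2
  · exact sub_eq_zero.mp h2
  · exact absurd h2 hf0

/-- **`a'(D,1) = 1` generically** (`D ≥ 1`): almost all (= all nonzero) forms of degree `D` in one
variable have a trivial stabilizer and reduced stabilizer period `1`.
[cite: BurgisserIkenmeyer2017, Thm. 2.3] -/
theorem isZariskiGeneric_reducedStabilizerPeriod_eq_one_fin_one {D : ℕ} (hD : 0 < D) :
    IsZariskiGeneric D fun f : MvPolynomial (Fin 1) ℂ =>
      HasTrivialStabilizer D f ∧ reducedStabilizerPeriod D f = 1 :=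
  (isZariskiGeneric_ne_zero (m := 1) one_pos D).mono fun _ hf hf0 =>
    ⟨hasTrivialStabilizer_of_fin_one hf hf0,
      reducedStabilizerPeriod_eq_one_of_hasTrivialStabilizer hf hD
        (hasTrivialStabilizer_of_fin_one hf hf0)⟩

end OneVariable

/-! ### The corrected theorem -/

section Corrected

/-- **BI 2017, Thm. 2.3, second sentence, AS CORRECTED (erratum A21) — the whole printed range
`D > 2`, `m ≥ 1`:** for a Zariski-generic form `w ∈ Sym^D ℂ^m`, the reduced stabilizer period is
`a'(w) = 1`, except `a'(w) = 2` when `(D,m) = (3,2)` or `(3,3)`. (The printed third exception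
`a'(4,3) = 2` is false; the typed verbatim fact `BI2017_thm_2_3_period` is refuted in the tree; this
theorem is its corrected reading.) Assembled from: `m ≥ 4` and ternary `D ≥ 4`
(`BI2017_thm_2_3_period_of_four_le`, `BI2017_thm_2_3_period_ternary_of_four_le`), `(3,3)`
(`BI2017_prop_A_5_conjunct_one`), binary forms (`BI2017_prop_A_4_holds`), one variable
(`isZariskiGeneric_reducedStabilizerPeriod_eq_one_fin_one`). [cite: BurgisserIkenmeyer2017, Thm. 2.3] -/
theorem BI2017_thm_2_3_period_corrected :
    ∀ (D m : ℕ), 2 < D → 1 ≤ m →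
      IsZariskiGeneric D fun f : MvPolynomial (Fin m) ℂ =>
        reducedStabilizerPeriod D f = if (D = 3 ∧ m = 2) ∨ (D = 3 ∧ m = 3) then 2 else 1 := by
  intro D m hD hm
  rcases m with _ | _ | _ | _ | m
  · exact absurd hm (by norm_num)
  · -- `m = 1`
    refine (isZariskiGeneric_reducedStabilizerPeriod_eq_one_fin_one (D := D) (by omega)).mono
      fun f _ h => ?_
    rw [if_neg (by omega)]
    exact h.2
  · -- `m = 2`: binary forms, BI App. Prop. 7.4
    obtain ⟨h3, h4, h5⟩ := BI2017_prop_A_4_holds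
    rcases Nat.lt_or_ge D 5 with hD5 | hD5
    · interval_cases D
      · refine h3.mono fun f _ h => ?_
        rw [if_pos (Or.inl ⟨rfl, rfl⟩)]
        exact h.2
      · refine h4.mono fun f _ h => ?_
        rw [if_neg (by omega)]
        exact h.2
    · refine (h5 D hD5).mono fun f _ h => ?_
      rw [if_neg (by omega)]
      exact h.2
  · -- `m = 3`: ternary forms
    rcases Nat.lt_or_ge D 4 with hD4 | hD4
    · have hD3 : D = 3 := by omega
      subst hD3
      refine BI2017_prop_A_5_conjunct_one.mono fun f _ h => ?_
      rw [if_pos (Or.inr ⟨rfl, rfl⟩)]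
      exact h
    · refine (BI2017_thm_2_3_period_ternary_of_four_le (D := D) hD4).mono fun f _ h => ?_
      rw [if_neg (by omega)]
      exact h
  · -- `m ≥ 4`
    refine (BI2017_thm_2_3_period_of_four_le (D := D) (m := m + 4) hD (by omega)).mono
      fun f _ h => ?_
    rw [if_neg (by omega)]
    exact h

/-- **The corrected table entries spelled out** (same content, per clause): generically
`a'(3,2) = 2`, `a'(3,3) = 2`, and `a'(D,m) = 1` for every other `D > 2`, `m ≥ 1`.
[cite: BurgisserIkenmeyer2017, Thm. 2.3] -/
theorem BI2017_thm_2_3_period_corrected_eq_one {D m : ℕ} (hD : 2 < D) (hm : 1 ≤ m)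
    (hexc : ¬ (D = 3 ∧ (m = 2 ∨ m = 3))) :
    IsZariskiGeneric D fun f : MvPolynomial (Fin m) ℂ => reducedStabilizerPeriod D f = 1 := by
  refine (BI2017_thm_2_3_period_corrected D m hD hm).mono fun f _ h => ?_
  rw [if_neg (by omega)] at h
  exact h

end Corrected

end Literature.Computability.AlgebraicComplexity
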